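import Summits.QuantumFields.YangMills.Theorems.BalabanUVNodesN08Thm2AtRecordLevelZero
import Literature.MathematicalPhysics.QuantumFieldTheory.Balaban1983to89.TorusGeometry

/-!
# BalabanUVNodes ∕ N08 — [Balaban1985UV3] Thm 2 at the runs of record: THE WINDOW CONDITION IS NECESSARY — a one-bond configuration shows that
# (47)₀ at the record's binders forces [7]'s level-0 class to contain every achievable plaquette size below a quarter of the (4)-window

Track A, DAG node N08 = T. Bałaban, CMP **102** (1985) 255–275 [Balaban1985UV3], (47) p. 267, (4) p. 256, (7) p. 257, (1) p. 256; [7] = [Balaban1985Variational]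
(2) p. 278; plaquette variables [Balaban1985Averaging] (9) p. 19.  Cell `pub-ymgap`, width seat `pub-ymgap-dag-n08-w1`, W-SEAT-START-LIST §n08 item 1 (file 6);
`--supports` K1⁷ `StabilityBAtRecordR13SepCoPH` (helper).  Companion of `BalabanUVNodesN08Thm2AtRecordLevelZero` §2 (`window_of_ineq47_zero`: (47)₀ at the
record's binders ⇒ every NON-FLAT configuration of the (4)-window is [7]-regular at level 0).

WHAT THIS FILE PROVES (kernel; theorems only).  §1 THE ONE-BOND CONFIGURATION `oneBond b₀ g := (b = b₀ ? g : 1)` on a torus of the record: every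
plaquette variable is a product of four factors in `{1, g, g⁻¹}`, so `|V(∂p) − 1| ≤ 4|g − 1|` (`dist1_plaqHol_oneBond_le`); the plaquette `⟨x₀, e₀, e₁⟩` through
`b₀ = ⟨x₀, e₀⟩` has variable EXACTLY `g` (`plaqHol_oneBond_self`, using `x + e₁ ≠ x` on a torus with `≥ 2` sites per direction), so its size is `|g − 1|` and
the Wilson action is `≥ 1 − Re tr g > 0` when `Re tr g < 1` (`wilsonAction4_oneBond_pos`).  §2 THE NECESSITY: if (47)₀ holds at the record's binders for tower
objects with (43)@0 (`LevelZero.window_of_ineq47_zero`), then **every `g ∈ SU(N)` with `Re tr g < 1` and `4|g − 1| < ε₁(0)` has `|g − 1| < εbg·η₀²`**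
(`dist1_lt_of_ineq47_zero`); contrapositively a group element with `εbg·η₀² ≤ |g − 1|`, `4|g − 1| < ε₁(0)`, `Re tr g < 1` REFUTES (47)₀ (`not_ineq47_zero_of_witness`).
So, up to the factor 4 and the group's spectrum of `|g − 1|` (on `SU(2)`, `diag(e^{iθ}, e^{−iθ})` realises every value in `[0, 2]` — not typed here), the class
radius must dominate the (4)-window: the side condition of `LevelZero` §2 is NECESSARY, not an artefact of the sufficient bounds of `LevelZero` §3 ∕ `WindowCeiling`.

HONEST FRAMING: count-neutral helper; N08 NOT discharged; nothing of [B10] asserted; one finite 𝕋⁴ programme at fixed ε, Bałaban AS PRINTED; nothing continuum ∕ ℝ⁴ ∕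
OS ∕ mass gap ∕ Clay.  No `sorry`, standard axioms.
-/

noncomputable section

namespace Summit.QuantumFields.YangMills.BalabanUVNodes.N08Thm2AtRecordWindowNecessity

open Literature.MathematicalPhysics.QuantumFieldTheory.Balaban1983to89
open Literature.MathematicalPhysics.QuantumFieldTheory.Balaban1983to89.Node00 (SU)
open Literature.MathematicalPhysics.QuantumFieldTheory.Balaban1983to89.B10RunsOfRecord
open Literature.MathematicalPhysics.QuantumFieldTheory.Balaban1985CMP102
open Literature.MathematicalPhysics.QuantumFieldTheory.Balaban1985CMP102.Setting
open Summit.QuantumFields.YangMills.BalabanUVNodes.N08Thm2AtRecordLevelZero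

/-! ## §1 The one-bond configuration on a torus -/
section OneBond

variable {P : Params} {j : ℕ} {G : Type*} [GaugeGroup G]

open Classical in
/-- The configuration equal to `g` on the bond `b₀` and to `1` elsewhere. [cite: Balaban1985Averaging, (3) p.18 (a gauge field configuration; bookkeeping)] -/
theorem exists_oneBond (b₀ : PBond P j) (g : G) :
    ∃ V : GaugeField P j G, V b₀ = g ∧ ∀ b, b ≠ b₀ → V b = 1 :=
  ⟨fun b => if b = b₀ then g else 1, by simp, fun b hb => by simp [hb]⟩

/-- `|h − 1| ≤ |g − 1|` for `h ∈ {1, g}`; with inverses, for the four factors of a plaquette variable. [folklore] -/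
private theorem dist1_le_of_oneBond {V : GaugeField P j G} {b₀ : PBond P j} {g : G} (hV : ∀ b, b ≠ b₀ → V b = 1) (hV₀ : V b₀ = g)
    (b : PBond P j) : dist1 (V b) ≤ dist1 g ∧ dist1 (V b)⁻¹ ≤ dist1 g := by
  by_cases hb : b = b₀
  · subst hb; rw [hV₀, GaugeGroup.dist1_inv]; exact ⟨le_rfl, le_rfl⟩
  · rw [hV b hb, inv_one, GaugeGroup.dist1_one]; exact ⟨GaugeGroup.dist1_nonneg g, GaugeGroup.dist1_nonneg g⟩

/-- **Every plaquette variable of the one-bond configuration is within `4|g − 1|` of `1`** (four factors in `{1, g, g⁻¹}`, `|ab − 1| ≤ |a − 1| + |b − 1|`).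
[cite: Balaban1985Averaging, (9) p.19 (plaquette variables; bookkeeping)] -/
theorem dist1_plaqHol_oneBond_le {V : GaugeField P j G} {b₀ : PBond P j} {g : G} (hV : ∀ b, b ≠ b₀ → V b = 1) (hV₀ : V b₀ = g)
    (p : Plaq P j) : dist1 (GaugeField.plaqHol V p) ≤ 4 * dist1 g := by
  unfold GaugeField.plaqHol
  have h1 := (dist1_le_of_oneBond hV hV₀ ⟨p.src, p.μ⟩).1
  have h2 := (dist1_le_of_oneBond hV hV₀ ⟨p.src.shift p.μ, p.ν⟩).1
  have h3 := (dist1_le_of_oneBond hV hV₀ ⟨p.src.shift p.ν, p.μ⟩).2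
  have h4 := (dist1_le_of_oneBond hV hV₀ ⟨p.src, p.ν⟩).2
  calc dist1 (V ⟨p.src, p.μ⟩ * V ⟨p.src.shift p.μ, p.ν⟩ * (V ⟨p.src.shift p.ν, p.μ⟩)⁻¹ * (V ⟨p.src, p.ν⟩)⁻¹)
      ≤ dist1 (V ⟨p.src, p.μ⟩ * V ⟨p.src.shift p.μ, p.ν⟩ * (V ⟨p.src.shift p.ν, p.μ⟩)⁻¹) + dist1 (V ⟨p.src, p.ν⟩)⁻¹ :=
        GaugeGroup.dist1_mul_le _ _
    _ ≤ dist1 (V ⟨p.src, p.μ⟩ * V ⟨p.src.shift p.μ, p.ν⟩) + dist1 (V ⟨p.src.shift p.ν, p.μ⟩)⁻¹ + dist1 (V ⟨p.src, p.ν⟩)⁻¹ := by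
        linarith [GaugeGroup.dist1_mul_le (V ⟨p.src, p.μ⟩ * V ⟨p.src.shift p.μ, p.ν⟩) (V ⟨p.src.shift p.ν, p.μ⟩)⁻¹]
    _ ≤ dist1 (V ⟨p.src, p.μ⟩) + dist1 (V ⟨p.src.shift p.μ, p.ν⟩) + dist1 (V ⟨p.src.shift p.ν, p.μ⟩)⁻¹ + dist1 (V ⟨p.src, p.ν⟩)⁻¹ := by
        linarith [GaugeGroup.dist1_mul_le (V ⟨p.src, p.μ⟩) (V ⟨p.src.shift p.μ, p.ν⟩)]
    _ ≤ 4 * dist1 g := by linarith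

/-- On a torus with at least two sites per direction, `x + e_ν ≠ x`. [folklore] -/
theorem shift_ne_self (h1 : 1 < P.sitesPerDir j) (x : Site P j) (ν : Fin P.d) : x.shift ν ≠ x := by
  intro h
  have h' := congrFun h ν
  simp only [Site.shift, Function.update_self] at h'
  haveI : Fact (1 < P.sitesPerDir j) := ⟨h1⟩
  have h0 : (1 : ZMod (P.sitesPerDir j)) = 0 := by linear_combination h'
  exact one_ne_zero h0

/-- **The plaquette through `b₀ = ⟨x₀, μ⟩` in directions `μ < ν` has variable exactly `g`** for the one-bond configuration (its other three bonds differ from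
`b₀`: two by direction, the third by `x₀ + e_ν ≠ x₀`). [cite: Balaban1985Averaging, (9) p.19 (bookkeeping)] -/
theorem plaqHol_oneBond_self {V : GaugeField P j G} {x₀ : Site P j} {μ ν : Fin P.d} (hμν : μ < ν) {g : G}
    (hV : ∀ b, b ≠ ⟨x₀, μ⟩ → V b = 1) (hV₀ : V ⟨x₀, μ⟩ = g) :
    GaugeField.plaqHol V ⟨x₀, μ, ν, hμν⟩ = g := by
  have hne : μ ≠ ν := ne_of_lt hμν
  have h2 : V ⟨x₀.shift μ, ν⟩ = 1 := hV _ (by intro h; exact hne (congrArg PBond.dir h).symm)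
  have h3 : V ⟨x₀.shift ν, μ⟩ = 1 := hV _ (by
    intro h; exact shift_ne_self (P.one_lt_sitesPerDir j) x₀ ν (congrArg PBond.src h))
  have h4 : V ⟨x₀, ν⟩ = 1 := hV _ (by intro h; exact hne (congrArg PBond.dir h).symm)
  show V ⟨x₀, μ⟩ * V ⟨x₀.shift μ, ν⟩ * (V ⟨x₀.shift ν, μ⟩)⁻¹ * (V ⟨x₀, ν⟩)⁻¹ = g
  rw [hV₀, h2, h3, h4, mul_one, inv_one, mul_one, mul_one]

/-- **The one-bond configuration is NOT FLAT when `Re tr g < 1`**: `A(V) ≥ 1 − Re tr V(∂p₀) = 1 − Re tr g > 0` (all terms `1 − Re tr ≥ 0`). [cite: Balaban1987RG1, (0.2) p.252 (the Wilson action; bookkeeping)] -/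
theorem wilsonAction4_oneBond_pos {V : GaugeField P j G} {x₀ : Site P j} {μ ν : Fin P.d} (hμν : μ < ν) {g : G}
    (hV : ∀ b, b ≠ ⟨x₀, μ⟩ → V b = 1) (hV₀ : V ⟨x₀, μ⟩ = g) (hre : reTr g < 1) : 0 < wilsonAction4 V := by
  unfold wilsonAction4 wilsonAction
  have hp₀ : (1 : ℝ) * (1 - reTr (GaugeField.plaqHol V ⟨x₀, μ, ν, hμν⟩)) = 1 - reTr g := by
    rw [plaqHol_oneBond_self hμν hV hV₀, one_mul]
  calc (0 : ℝ) < 1 - reTr g := by linarith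
    _ = (1 : ℝ) * (1 - reTr (GaugeField.plaqHol V ⟨x₀, μ, ν, hμν⟩)) := hp₀.symm
    _ ≤ ∑ p : Plaq P j, 1 * (1 - reTr (GaugeField.plaqHol V p)) :=
        Finset.single_le_sum (f := fun p : Plaq P j => (1 : ℝ) * (1 - reTr (GaugeField.plaqHol V p)))
          (fun p _ => by have := GaugeGroup.reTr_le_one (GaugeField.plaqHol V p); linarith) (Finset.mem_univ _)

end OneBond

/-! ## §2 The necessity of the window condition at the record's binders -/
section Necessity

variable {N : ℕ} [NeZero N] {L : ℕ} {𝔞 : ∀ S : Scales L, ∀ j, Averaging S.P j (SU N)}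
  {𝔗 : ∀ S : Scales L, ∀ j, RTOpI S.P j (SU N) (𝔞 S j)} {c : Consts L} {S : Scales L} {W : SectB.TowerObjects S (SU N)}

/-- `d = 3`: the directions `e₀ < e₁` exist on the record's lattices. [cite: Balaban1985UV3, (1) p.256 «d = 3» (bookkeeping)] -/
theorem zero_lt_one_dir (S : Scales L) : (⟨0, by show 0 < 3; norm_num⟩ : Fin S.P.d) < ⟨1, by show 1 < 3; norm_num⟩ :=
  Fin.mk_lt_mk.mpr zero_lt_one

/-- ★ **A GROUP ELEMENT REFUTING (47)₀**: if `g ∈ SU(N)` has `Re tr g < 1`, `4|g − 1| < ε₁(0)` (so the one-bond configuration lies in the (4)-window and is not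
flat) and `εbg·η₀² ≤ |g − 1|` (so it is NOT in [7]'s level-0 class), then (47)₀ FAILS at the record's binders for every tower objects with (43)@0.
[cite: Balaban1985UV3, (47) p.267 + (4) p.256 + (7) p.257; Balaban1985Variational, (2) p.278] -/
theorem not_ineq47_zero_of_witness (hW : W.toRunObjects = runObjects₀A N 𝔞 𝔗 (Backgrounds.ofAvg N L 𝔞) c S)
    (hP0 : ∀ (h : W.Hist 0) (V : GaugeField S.P 0 (SU N)), W.Pint 0 h V = 0) (g : SU N) (hre : reTr g < 1)
    (h4 : 4 * dist1 g < eps1OfPrint c S 0) (hbig : c.εbg * S.eta 0 ^ 2 ≤ dist1 g) : ¬ B10.Ineq47 W.pin.toTowerRun 0 := by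
  intro h47
  obtain ⟨V, hV₀, hV⟩ := exists_oneBond (⟨fun _ => 0, ⟨0, by show 0 < 3; norm_num⟩⟩ : PBond S.P 0) g
  have hwin : PlaqSmall (eps1OfPrint c S 0) V := fun p => lt_of_le_of_lt (dist1_plaqHol_oneBond_le hV hV₀ p) h4
  have hA : 0 < wilsonAction4 V := wilsonAction4_oneBond_pos (zero_lt_one_dir S) hV hV₀ hre
  have hreg := window_of_ineq47_zero hW hP0 h47 V hwin hA ⟨fun _ => 0, ⟨0, by show 0 < 3; norm_num⟩, ⟨1, by show 1 < 3; norm_num⟩, zero_lt_one_dir S⟩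
  rw [plaqHol_oneBond_self (zero_lt_one_dir S) hV hV₀] at hreg
  exact absurd hreg (not_lt.mpr hbig)

/-- ★★ **THE WINDOW CONDITION IS NECESSARY** (contrapositive form): if (47)₀ holds at the record's binders (tower objects with (43)@0), then every `g ∈ SU(N)` with
`Re tr g < 1` and `4|g − 1| < ε₁(0)` lies within [7]'s level-0 radius: `|g − 1| < εbg·η₀²`.  Up to the factor `4` and the group's spectrum of `|g − 1|`, [7]'s class
radius must dominate print's (4)-window at the constants of record. [cite: Balaban1985UV3, (47) p.267 + (4) p.256 + (7) p.257; Balaban1985Variational, (2) p.278] -/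
theorem dist1_lt_of_ineq47_zero (hW : W.toRunObjects = runObjects₀A N 𝔞 𝔗 (Backgrounds.ofAvg N L 𝔞) c S)
    (hP0 : ∀ (h : W.Hist 0) (V : GaugeField S.P 0 (SU N)), W.Pint 0 h V = 0) (h47 : B10.Ineq47 W.pin.toTowerRun 0)
    (g : SU N) (hre : reTr g < 1) (h4 : 4 * dist1 g < eps1OfPrint c S 0) : dist1 g < c.εbg * S.eta 0 ^ 2 := by
  by_contra hbig
  exact not_ineq47_zero_of_witness hW hP0 g hre h4 (not_lt.mp hbig) h47

end Necessity

end Summit.QuantumFields.YangMills.BalabanUVNodes.N08Thm2AtRecordWindowNecessity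

end
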